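import Literature.NumberTheory.Transcendental.SiegelEntries
import HarnessLib

/-!
# The Siegel system of Baker's method on `M_κ`: unknowns, equations, integrality, house bound

Topic: `Literature/NumberTheory/Transcendental`. Plan item W4/S4 (fourth sub-brick) of the unit
`provefact-Literature.NumberTheory.Transcendental.H-b596640137`. The linear system solved by
Siegel's lemma in the construction of the auxiliary function (sequel `AuxiliaryFunction.lean`):

* unknowns `UIdx = ((β ⊕ (γ ⊕ δ)) → Fin (D'+1))` (exponent vectors `νOf u`, `|νOf u| ≤ nD'`,
  `νOf` injective), equations `EIdx = Fin (S₀+1) × Fin T × (Fin dd → Fin T)` (point `s·v`, length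
  `k`, content `α`);
* `sMat` — the matrix with entries `d_s^{E(D,k)} · ∑_{ω of content α} entryVal s ω D (νOf u) ∈ 𝓞 K`
  (`SiegelEntries.entryVal_bounds`), `rowSum_eq_zero_of_mulVec` — a solution kills the row sums;
* `house_sMat_le` — every entry has house `≤ houseBound D' T S₀`, an explicit expression
  (`|d₁|^{(S₀+1)E}·(dd+1)^T·(nD'hdeg+2T+1)^T·max(1,qB)^T·hB^{nD'}·((S₀+1)M^{S₀+1})^{nD'hdeg+2T}`),
  `one_le_houseBound`.

## References

* A. Baker, G. Wüstholz, *Logarithmic Forms and Diophantine Geometry*, CUP 2007, §6.8 (p. 118).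
-/

noncomputable section

open Complex MvPolynomial Finset NumberField
open Literature.NumberTheory.Transcendental.ArithPoly
open Literature.NumberTheory.Transcendental.Chudnovsky
open scoped PeriodPair

namespace Literature.NumberTheory.Transcendental

namespace GaGmE

namespace Std

namespace BakerData

variable {β γ δ : Type} [Fintype β] [Fintype γ] [Fintype δ] [DecidableEq γ]
variable (B : BakerData β γ δ)

/-! ### Unknowns and equations -/

/-- The unknowns: exponent vectors with entries `≤ D'`. [folklore] -/
abbrev UIdx (β γ δ : Type) (D' : ℕ) : Type := (β ⊕ (γ ⊕ δ)) → Fin (D' + 1)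

/-- The exponent vector of an unknown. [folklore] -/
def νOf {D' : ℕ} (u : UIdx β γ δ D') : (β ⊕ (γ ⊕ δ)) →₀ ℕ :=
  Finsupp.equivFunOnFinite.symm fun a => (u a : ℕ)

omit [Fintype γ] [DecidableEq γ] [Fintype β] [Fintype δ] in
/-- `νOf u a = u a`. [folklore] -/
@[simp] theorem νOf_apply [Fintype β] [Fintype γ] [Fintype δ] {D' : ℕ} (u : UIdx β γ δ D') (a : β ⊕ (γ ⊕ δ)) :
    νOf u a = (u a : ℕ) := by
  simp [νOf]

omit [DecidableEq γ] in
/-- `νOf` is injective. [folklore] -/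
theorem νOf_injective {D' : ℕ} : Function.Injective (νOf (β := β) (γ := γ) (δ := δ) (D' := D')) := by
  intro u u' h
  funext a
  have := congrArg (fun ν => ν a) h
  simp only [νOf_apply] at this
  exact Fin.ext this

omit [DecidableEq γ] in
/-- `|νOf u| ≤ n · D'`. [folklore] -/
theorem degree_νOf_le {D' : ℕ} (u : UIdx β γ δ D') :
    (νOf u).degree ≤ Fintype.card (β ⊕ (γ ⊕ δ)) * D' := by
  rw [Finsupp.degree_eq_sum]
  calc ∑ a, νOf u a ≤ ∑ _a : β ⊕ (γ ⊕ δ), D' := Finset.sum_le_sum fun a _ => by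
          rw [νOf_apply]; exact Nat.lt_succ_iff.mp (u a).isLt
    _ = Fintype.card (β ⊕ (γ ⊕ δ)) * D' := by simp

/-- The equations: `(s, k, α)` with `s ≤ S₀`, `k < T`, `α : Fin dd → Fin T` a content. [folklore] -/
abbrev EIdx (T S₀ : ℕ) : Type := Fin (S₀ + 1) × Fin T × (Fin B.dd → Fin T)

/-- The words of length `k` and content `α`. [folklore] -/
def wordsOf (k : ℕ) {T : ℕ} (α : Fin B.dd → Fin T) : Finset (Fin k → Fin B.dd) :=
  Finset.univ.filter fun ω => ∀ m, PolyODE.content ω m = (α m : ℕ)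

/-- The row sums `∑_{ω of content α} entryVal s ω D ν`. [folklore] -/
def rowSum (D s k : ℕ) {T : ℕ} (α : Fin B.dd → Fin T) (ν : (β ⊕ (γ ⊕ δ)) →₀ ℕ) : B.K :=
  ∑ ω ∈ B.wordsOf k α, B.entryVal s ω D ν

/-- The exponent of the denominator clearing row `(s, k)`. [folklore] -/
def expE (D k : ℕ) : ℕ := 2 * D + k * 3 + (D * B.hdeg + 2 * k)

/-- `d_s^E · rowSum ∈ 𝓞_K`. [folklore] -/
theorem isIntegral_rowSum (D s k : ℕ) {T : ℕ} (α : Fin B.dd → Fin T) {ν : (β ⊕ (γ ⊕ δ)) →₀ ℕ}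
    (hν : ν.degree ≤ D) : B.IntZ ((B.dAt s : B.K) ^ B.expE D k * B.rowSum D s k α ν) := by
  show IsIntegral ℤ _
  rw [rowSum, Finset.mul_sum]
  refine IsIntegral.sum _ fun ω _ => ?_
  exact (B.entryVal_bounds B.emb s ω hν).2

/-- `d_s ≠ 0` in `K`. [folklore] -/
theorem dAt_ne_zero (s : ℕ) : (B.dAt s : B.K) ≠ 0 := by
  have hden : (B.den : ℤ) ≠ 0 := B.gens.den_ne_zero
  have : (B.dAt s : ℤ) ≠ 0 := by
    simp only [dAt, d₁]
    exact pow_ne_zero _ (mul_ne_zero two_ne_zero hden)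
  exact_mod_cast this

/-- **The matrix of the Siegel system** (entries in `𝓞 K`). [cite: BakerWustholz2007, §6.8 (p. 118)] -/
def sMat (D' T S₀ : ℕ) : Matrix (B.EIdx T S₀) (UIdx β γ δ D') (𝓞 B.K) := fun r u =>
  ⟨(B.dAt r.1 : B.K) ^ B.expE (Fintype.card (β ⊕ (γ ⊕ δ)) * D') r.2.1 *
      B.rowSum (Fintype.card (β ⊕ (γ ⊕ δ)) * D') r.1 r.2.1 r.2.2 (νOf u),
    B.isIntegral_rowSum _ _ _ _ (degree_νOf_le u)⟩

/-- The value of an entry in `K`. [folklore] -/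
@[simp] theorem coe_sMat (D' T S₀ : ℕ) (r : B.EIdx T S₀) (u : UIdx β γ δ D') :
    ((B.sMat D' T S₀ r u : 𝓞 B.K) : B.K) =
      (B.dAt r.1 : B.K) ^ B.expE (Fintype.card (β ⊕ (γ ⊕ δ)) * D') r.2.1 *
        B.rowSum (Fintype.card (β ⊕ (γ ⊕ δ)) * D') r.1 r.2.1 r.2.2 (νOf u) := rfl

variable [DecidableEq β] [DecidableEq δ]

/-- **A solution of the Siegel system kills the row sums**: if `sMat ξ = 0` then for every row
`∑_u ξ_u · rowSum_u = 0` in `K`. [folklore] -/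
theorem rowSum_eq_zero_of_mulVec {D' T S₀ : ℕ} {ξ : UIdx β γ δ D' → 𝓞 B.K}
    (h : (B.sMat D' T S₀).mulVec ξ = 0) (r : B.EIdx T S₀) :
    ∑ u, (ξ u : B.K) * B.rowSum (Fintype.card (β ⊕ (γ ⊕ δ)) * D') r.1 r.2.1 r.2.2 (νOf u) = 0 := by
  have hr := congrFun h r
  simp only [Matrix.mulVec, dotProduct, Pi.zero_apply] at hr
  have hr' := congrArg (algebraMap (𝓞 B.K) B.K) hr
  rw [map_sum, map_zero] at hr'
  simp only [map_mul] at hr'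
  have e : ∑ u, algebraMap (𝓞 B.K) B.K (B.sMat D' T S₀ r u) * algebraMap (𝓞 B.K) B.K (ξ u) =
      (B.dAt r.1 : B.K) ^ B.expE (Fintype.card (β ⊕ (γ ⊕ δ)) * D') r.2.1 *
        ∑ u, (ξ u : B.K) * B.rowSum (Fintype.card (β ⊕ (γ ⊕ δ)) * D') r.1 r.2.1 r.2.2 (νOf u) := by
    rw [Finset.mul_sum]
    refine Finset.sum_congr rfl fun u _ => ?_
    rw [show algebraMap (𝓞 B.K) B.K (B.sMat D' T S₀ r u) = ((B.sMat D' T S₀ r u : 𝓞 B.K) : B.K) from rfl,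
      coe_sMat]
    rw [show algebraMap (𝓞 B.K) B.K (ξ u) = ((ξ u : 𝓞 B.K) : B.K) from rfl]
    ring
  rw [e] at hr'
  exact (mul_eq_zero.mp hr').resolve_left (pow_ne_zero _ (B.dAt_ne_zero _))

/-! ### The house bound of the entries -/

omit [DecidableEq β] [DecidableEq δ] in
/-- `|d₁| ≥ 1` (indeed `≥ 2`). [folklore] -/
theorem one_le_abs_d₁ : (1 : ℝ) ≤ |(B.d₁ : ℝ)| := by
  have h := B.gens.one_le_abs_den
  have e : (B.d₁ : ℝ) = 2 * (B.den : ℝ) := by simp [d₁]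
  rw [e, abs_mul, abs_two]
  nlinarith [abs_nonneg (B.den : ℝ)]

omit [DecidableEq β] [DecidableEq δ] in
/-- `expE` is monotone in `k`. [folklore] -/
theorem expE_mono (D : ℕ) {k k' : ℕ} (h : k ≤ k') : B.expE D k ≤ B.expE D k' := by
  unfold expE; omega

/-- **The uniform house bound** of the Siegel matrix (explicit in `D = nD'`, `T`, `S₀`).
[cite: BakerWustholz2007, §6.8 (p. 118: "algebraic integers with sizes at most …")] -/
def houseBound (D' T S₀ : ℕ) : ℝ :=
  (|(B.d₁ : ℝ)|) ^ ((S₀ + 1) * B.expE (Fintype.card (β ⊕ (γ ⊕ δ)) * D') T) * ((B.dd : ℝ) + 1) ^ T *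
    (((Fintype.card (β ⊕ (γ ⊕ δ)) * D' * B.hdeg : ℕ) : ℝ) + 2 * T + 1) ^ T * (max 1 B.qB) ^ T *
    B.hB ^ (Fintype.card (β ⊕ (γ ⊕ δ)) * D') *
    ((S₀ + 1) * B.M ^ (S₀ + 1)) ^ (Fintype.card (β ⊕ (γ ⊕ δ)) * D' * B.hdeg + 2 * T)

omit [DecidableEq β] [DecidableEq δ] in
/-- `1 ≤ (S₀+1) M^{S₀+1}`. [folklore] -/
theorem one_le_MS (S₀ : ℕ) : (1 : ℝ) ≤ (S₀ + 1) * B.M ^ (S₀ + 1) := by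
  have hM := B.gens.one_le_M
  have h1 : (1 : ℝ) ≤ S₀ + 1 := by have : (0:ℝ) ≤ S₀ := Nat.cast_nonneg S₀; linarith
  exact one_le_mul_of_one_le_of_one_le h1 (one_le_pow₀ hM)

omit [DecidableEq β] [DecidableEq δ] in
/-- `1 ≤ houseBound`. [folklore] -/
theorem one_le_houseBound (D' T S₀ : ℕ) : 1 ≤ B.houseBound D' T S₀ := by
  unfold houseBound
  have h1 := B.one_le_abs_d₁
  have h2 : (1 : ℝ) ≤ (B.dd : ℝ) + 1 := by have : (0:ℝ) ≤ B.dd := Nat.cast_nonneg _; linarith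
  have h3 : (1 : ℝ) ≤ (((Fintype.card (β ⊕ (γ ⊕ δ)) * D' * B.hdeg : ℕ) : ℝ) + 2 * T + 1) := by
    have : (0:ℝ) ≤ ((Fintype.card (β ⊕ (γ ⊕ δ)) * D' * B.hdeg : ℕ) : ℝ) := Nat.cast_nonneg _
    have : (0:ℝ) ≤ T := Nat.cast_nonneg _
    linarith
  have h4 : (1 : ℝ) ≤ max 1 B.qB := le_max_left _ _
  have h5 := B.one_le_hB
  have h6 := B.one_le_MS S₀
  have hAB := one_le_mul_of_one_le_of_one_le (one_le_pow₀ (n := (S₀ + 1) * B.expE (Fintype.card (β ⊕ (γ ⊕ δ)) * D') T) h1)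
    (one_le_pow₀ (n := T) h2)
  have hABC := one_le_mul_of_one_le_of_one_le hAB (one_le_pow₀ (n := T) h3)
  have h4' := one_le_mul_of_one_le_of_one_le hABC (one_le_pow₀ (n := T) h4)
  have h5' := one_le_mul_of_one_le_of_one_le h4' (one_le_pow₀ (n := Fintype.card (β ⊕ (γ ⊕ δ)) * D') h5)
  exact one_le_mul_of_one_le_of_one_le h5' (one_le_pow₀ h6)

omit [DecidableEq β] [DecidableEq δ] in
/-- The number of words of content `α` and length `k` is at most `(dd+1)^T` for `k ≤ T`. [folklore] -/
theorem card_wordsOf_le (k : ℕ) {T : ℕ} (hk : k ≤ T) (α : Fin B.dd → Fin T) :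
    ((B.wordsOf k α).card : ℝ) ≤ ((B.dd : ℝ) + 1) ^ T := by
  have h1 : (B.wordsOf k α).card ≤ B.dd ^ k := by
    refine (Finset.card_filter_le _ _).trans ?_
    simp [Finset.card_univ]
  have h2 : ((B.dd : ℝ)) ^ k ≤ ((B.dd : ℝ) + 1) ^ k :=
    pow_le_pow_left₀ (Nat.cast_nonneg _) (by linarith) k
  have h3 : ((B.dd : ℝ) + 1) ^ k ≤ ((B.dd : ℝ) + 1) ^ T :=
    pow_le_pow_right₀ (by have : (0:ℝ) ≤ B.dd := Nat.cast_nonneg _; linarith) hk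
  calc ((B.wordsOf k α).card : ℝ) ≤ ((B.dd ^ k : ℕ) : ℝ) := by exact_mod_cast h1
    _ = (B.dd : ℝ) ^ k := by push_cast; ring
    _ ≤ ((B.dd : ℝ) + 1) ^ T := h2.trans h3

omit [DecidableEq β] [DecidableEq δ] in
/-- **Every entry of the Siegel matrix has house `≤ houseBound`.**
[cite: BakerWustholz2007, §6.8 (p. 118)] -/
theorem house_sMat_le (D' T S₀ : ℕ) (r : B.EIdx T S₀) (u : UIdx β γ δ D') :
    house ((B.sMat D' T S₀ r u : 𝓞 B.K) : B.K) ≤ B.houseBound D' T S₀ := by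
  obtain ⟨⟨s, hs⟩, ⟨k, hk⟩, α⟩ := r
  set n := Fintype.card (β ⊕ (γ ⊕ δ)) with hn
  set D := n * D' with hD
  have hsS : s ≤ S₀ := Nat.lt_succ_iff.mp hs
  have hkT : k ≤ T := hk.le
  have hν : (νOf u).degree ≤ D := degree_νOf_le u
  -- constants
  have hd1 := B.one_le_abs_d₁
  have hMs1 : (1 : ℝ) ≤ (s + 1) * B.M ^ (s + 1) := B.one_le_MS s
  have hMS := B.one_le_MS S₀
  have hhB := B.one_le_hB
  have hq1 : (1 : ℝ) ≤ max 1 B.qB := le_max_left _ _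
  have hN1 : (1 : ℝ) ≤ (((D * B.hdeg : ℕ) : ℝ) + 2 * T + 1) := by
    have : (0:ℝ) ≤ ((D * B.hdeg : ℕ) : ℝ) := Nat.cast_nonneg _
    have : (0:ℝ) ≤ T := Nat.cast_nonneg _
    linarith
  -- the bound for one entry value, made uniform
  have hentry : ∀ (σ : B.K →+* ℂ) (ω : Fin k → Fin B.dd),
      ‖σ (B.entryVal s ω D (νOf u))‖ ≤ (((D * B.hdeg : ℕ) : ℝ) + 2 * T + 1) ^ T * (max 1 B.qB) ^ T *
        B.hB ^ D * ((S₀ + 1) * B.M ^ (S₀ + 1)) ^ (D * B.hdeg + 2 * T) := by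
    intro σ ω
    refine (B.entryVal_bounds σ s ω hν).1.trans ?_
    have e1 : (((D * B.hdeg : ℕ) : ℝ) + 2 * k) ^ k ≤ (((D * B.hdeg : ℕ) : ℝ) + 2 * T + 1) ^ T := by
      refine (pow_le_pow_left₀ (by positivity) ?_ k).trans (pow_le_pow_right₀ hN1 hkT)
      have : (k : ℝ) ≤ T := by exact_mod_cast hkT
      linarith
    have e2 : B.qB ^ k ≤ (max 1 B.qB) ^ T :=
      (pow_le_pow_left₀ B.qB_nonneg (le_max_right _ _) k).trans (pow_le_pow_right₀ hq1 hkT)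
    have e3 : ((s + 1 : ℝ) * B.M ^ (s + 1)) ^ (D * B.hdeg + 2 * k) ≤
        ((S₀ + 1 : ℝ) * B.M ^ (S₀ + 1)) ^ (D * B.hdeg + 2 * T) := by
      have hbase : (s + 1 : ℝ) * B.M ^ (s + 1) ≤ (S₀ + 1) * B.M ^ (S₀ + 1) := by
        have hM := B.gens.one_le_M
        have : (s : ℝ) ≤ S₀ := by exact_mod_cast hsS
        exact mul_le_mul (by linarith) (pow_le_pow_right₀ hM (by omega)) (by positivity) (by positivity)
      exact (pow_le_pow_left₀ (by positivity) hbase _).trans (pow_le_pow_right₀ hMS (by omega))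
    have hB0 : 0 ≤ B.hB ^ D := pow_nonneg (zero_le_one.trans hhB) _
    exact mul_le_mul (mul_le_mul (mul_le_mul e1 e2 (pow_nonneg B.qB_nonneg _) (by positivity)) le_rfl hB0
      (by positivity)) e3 (by positivity) (by positivity)
  -- assemble
  refine B.gens.house_le_of_forall_norm_le (zero_le_one.trans (B.one_le_houseBound D' T S₀)) fun σ => ?_
  rw [coe_sMat]
  simp only
  rw [map_mul, map_pow, norm_mul, norm_pow]
  have hdcast : ‖σ ((B.dAt s : ℤ) : B.K)‖ = (|(B.d₁ : ℝ)|) ^ (s + 1) := by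
    rw [map_intCast, Complex.norm_intCast, dAt]
    push_cast
    rw [abs_pow]
  rw [hdcast, ← pow_mul]
  have hrow : ‖σ (B.rowSum D s k α (νOf u))‖ ≤ ((B.dd : ℝ) + 1) ^ T *
      ((((D * B.hdeg : ℕ) : ℝ) + 2 * T + 1) ^ T * (max 1 B.qB) ^ T * B.hB ^ D *
        ((S₀ + 1) * B.M ^ (S₀ + 1)) ^ (D * B.hdeg + 2 * T)) := by
    rw [rowSum, map_sum]
    refine (norm_sum_le _ _).trans ?_
    refine (Finset.sum_le_sum fun ω _ => hentry σ ω).trans ?_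
    rw [Finset.sum_const, nsmul_eq_mul]
    refine mul_le_mul_of_nonneg_right (B.card_wordsOf_le k hkT α) ?_
    have := B.one_le_MS S₀
    positivity
  have hdpow : (|(B.d₁ : ℝ)|) ^ ((s + 1) * B.expE D k) ≤ (|(B.d₁ : ℝ)|) ^ ((S₀ + 1) * B.expE D T) :=
    pow_le_pow_right₀ hd1 (Nat.mul_le_mul (by omega) (B.expE_mono D hkT))
  unfold houseBound
  rw [← hn, ← hD]
  refine (mul_le_mul hdpow hrow (norm_nonneg _) (by positivity)).trans (le_of_eq ?_)
  push_cast
  ring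

end BakerData

end Std

end GaGmE

end Literature.NumberTheory.Transcendental

end
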